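import Summits.QuantumFields.BalabanUV.Beta.GAN24.DirichletVertexWindowLocal
import Summits.QuantumFields.BalabanUV.Beta.GAN24.DirichletVertexLocalSums
import Summits.QuantumFields.BalabanUV.Beta.GAN24.DirichletVertexDomSum

/-!
# `BalabanUV.Beta.GAN24.DirichletVertexDomSumU` — binder row G-an2-4 / (CONV-C), road P2 PART IV, leaf L14 (the torus transfer), FILE U5b:
# THE SUMMED WEIGHTED INTERIOR HESSIAN WITH A VOLUME-FREE CONSTANT — `|V| ↦ 4`, `20·|Tor M| ↦ 80` by the star-box identity
# (unit b2b-balaban-gan24-p2, gen 27, v1; volume-uniform twin of `DirichletVertexDomSum` p247015)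

HONEST FRAMING (cell contract, verbatim): «discharging `BetaPertH` makes Bałaban's UV stability UNCONDITIONAL — a real constructive-QFT
result; it is NOT the continuum limit and NOT the Clay problem.»  SUPPLIER module under the T⁴-DAG sub-row `T4-U1a.S-NE2-D1-DIRICHLET°`.
`DirichletVertexDomSum.dom_sum_solExt` (p247015) has the constant `α_dom = C_g|V|α₁ + g_max·20|Tor M|·c_U` (LOCATED L27-1 of memo
`gen27/L14-END.md`: VOLUME-dependent).  With the window bounds in STAR-BOX currencies (`DirichletVertexWindowLocal`, `DirichletVertexLocalSums`)
and the star-box identity `Σ_b boxSum F = 4·Σ_x F` (`DirichletVertexStarBox`, p247556), the same pointwise domination (`DirichletVertexDom.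
dom_pointwise`, p246751) sums to `α_domU = 4C_g·α₁ + 80·g_max·c_U` — NO `|V|`, NO `|Tor M|`.

## Contents ([folklore]; 0 sorry)
* §1 `sum_family_eq`, `cLoc` (the star-box window currency of one vertex), `sum_cLoc` (`Σ_b cLoc b = 4·cWin`);
  `sum_WH_le_unif` (≤ 4·(2C_J E + C′_J B)), `sum_WP_le_unif` (≤ 4·cWin), `sum_WT_le_unif` (≤ 60·cWin), `sum_WI_le_unif` (≤ 16·cWin).
* §2 **`dom_sum_field_unif`**; §3 `alphaDomU`, **`dom_sum_solExt_unif`** (generic decidable `p ↔ blockReg`).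

ABSOLUTE RULE (cell, verbatim): «No internally-minted statement may enter as a cited fact. Every hypothesis is either kernel-proved in
this package or a verbatim quotation of a PUBLISHED theorem with page reference. The manuscript(s) under audit are NOT citable for
their own disputed steps — they are the thing under adjudication; programme-internal (2001/route/tribunal) claims are never citable.»
Nothing printed is a hypothesis.  NOT CLAIMED: (Φ)/(Φ′), the END (next file); constants `10⁹/(γ−1)`, `128⁴` not optimised; NOT NE2,
(CONV-C), `BetaPertH`, continuum, Clay.  «not in print; our proof attempt».  HONEST DEPENDENCY: continuum YM on T⁴ ⇐ BetaPertH ∧ nine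
spine estimates (0/9 proved); BetaPertH ⇐ (D1) ∧ (D4) ∧ CAP+tail; G-an2-4 gates asym, D1 and NE2/3/4.
-/

noncomputable section

open scoped BigOperators ComplexConjugate Matrix
open Finset

namespace Summit.QuantumFields.BalabanUV.Beta.GAN24.DirichletVertexDomSumU

open Literature.MathematicalPhysics.QuantumFieldTheory.Balaban1983to89.B5Prop11Plancherel (Tor fine unitVec)
open Literature.MathematicalPhysics.QuantumFieldTheory.Balaban1983to89.B5Action121 (sdiff LapS)
open Literature.MathematicalPhysics.QuantumFieldTheory.Balaban1983to89.B5Prop11Lower (nsq nsq_nonneg)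
open Summit.QuantumFields.BalabanUV.T4Continuum.ScalarAveragedPropagator (gammaPs gammaPs_pos dirichlet)
open Summit.QuantumFields.BalabanUV.Beta.GAN24.DirichletBoxRegularity (Pdir)
open Summit.QuantumFields.BalabanUV.Beta.GAN24.DirichletBoxTrace (blockReg)
open Summit.QuantumFields.BalabanUV.Beta.GAN24.DirichletBoxCompression (solExt solExt_apply_of_not dirichlet_solExt_le
  sum_normSq_LapS_solExt_le nsq_solExt_le)
open DirichletRingCutoff (tIdx)
open DirichletRingHessianWindow (rho)
open DirichletVertexChart
open DirichletVertexHessian (hessW hessW_nonneg alphaV)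
open DirichletVertexLocalT (WprodT plainWT plainWT_nonneg)
open DirichletVertexPiece (IsolatedAt pieceW pieceW_nonneg)
open DirichletVertexLocate (TT IsProdAt)
open DirichletVertexLocalW (Awin Bwin hW_corner hW_both hW_fst hW_snd)
open DirichletVertexStarBox (boxSum sum_boxSum_TT)
open DirichletVertexWindowLocal (plainWT_hessian_le_box pieceW_hessian_le_box)
open DirichletVertexLocalSums (sum_vertex_hessian_le)
open DirichletVertexDom
open DirichletVertexDomSum (En Bn cWin cU En_nonneg Bn_nonneg cWin_nonneg nL_le_128 sum_family_le)

variable (n : ℕ) [NeZero n] (M : Fin 2 → ℕ) [hM : ∀ μ, NeZero (M μ)] (S : Tor M → Prop) [DecidablePred S]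

/-! ## §1 The families with star-box currencies -/

omit [DecidablePred S] in
/-- exchange of a family sum with the site/direction sums. [folklore] -/
theorem sum_family_eq {ι : Type*} (I : Finset ι) (W : ι → Tor (fine n M) → ℝ) (F : Fin 2 → Tor (fine n M) → ℝ) :
    ∑ μ, ∑ x, (∑ i ∈ I, W i x) * F μ x = ∑ i ∈ I, ∑ μ, ∑ x, W i x * F μ x := by
  calc ∑ μ, ∑ x, (∑ i ∈ I, W i x) * F μ x = ∑ μ, ∑ x, ∑ i ∈ I, W i x * F μ x := by simp only [sum_mul]
    _ = ∑ μ, ∑ i ∈ I, ∑ x, W i x * F μ x := sum_congr rfl fun μ _ => sum_comm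
    _ = _ := sum_comm

section Field

variable {u : Tor (fine n M) → ℂ}

/-- the STAR-BOX WINDOW CURRENCY of the vertex `b`:
`2·boxSum(𝟙_Ω|Δu|²) + 32(n/L)²(boxSum|∂₀u|² + boxSum|∂₁u|²) + 16(n/L)⁴·boxSum|u|²` (identity orientation). [folklore] -/
def cLoc (u : Tor (fine n M) → ℂ) (b : Tor M) : ℝ :=
  2 * boxSum n M (fun x => if blockReg n M S x then ‖(LapS (fine n M) (n : ℂ) *ᵥ u) x‖ ^ 2 else 0) TT b
    + 32 * ((n : ℝ) / Ln n) ^ 2 * (boxSum n M (fun x => ‖(sdiff (fine n M) (n : ℂ) 0 *ᵥ u) x‖ ^ 2) TT b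
      + boxSum n M (fun x => ‖(sdiff (fine n M) (n : ℂ) 1 *ᵥ u) x‖ ^ 2) TT b)
    + 16 * ((n : ℝ) / Ln n) ^ 4 * boxSum n M (fun x => ‖u x‖ ^ 2) TT b

/-- `0 ≤ cLoc`. [folklore] -/
theorem cLoc_nonneg (u : Tor (fine n M) → ℂ) (b : Tor M) : 0 ≤ cLoc n M S u b := by
  have h1 : 0 ≤ boxSum n M (fun x => if blockReg n M S x then ‖(LapS (fine n M) (n : ℂ) *ᵥ u) x‖ ^ 2 else 0) TT b :=
    sum_nonneg fun _ _ => sum_nonneg fun _ _ => by dsimp only; split_ifs <;> positivity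
  have h2 : 0 ≤ boxSum n M (fun x => ‖(sdiff (fine n M) (n : ℂ) 0 *ᵥ u) x‖ ^ 2) TT b := sum_nonneg fun _ _ => sum_nonneg fun _ _ => sq_nonneg _
  have h3 : 0 ≤ boxSum n M (fun x => ‖(sdiff (fine n M) (n : ℂ) 1 *ᵥ u) x‖ ^ 2) TT b := sum_nonneg fun _ _ => sum_nonneg fun _ _ => sq_nonneg _
  have h4 : 0 ≤ boxSum n M (fun x => ‖u x‖ ^ 2) TT b := sum_nonneg fun _ _ => sum_nonneg fun _ _ => sq_nonneg _
  have hb : (0 : ℝ) ≤ (n : ℝ) / Ln n := div_nonneg (Nat.cast_nonneg _) (Nat.cast_nonneg _)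
  have h5 : (0 : ℝ) ≤ ((n : ℝ) / Ln n) ^ 2 := pow_nonneg hb _
  have h6 : (0 : ℝ) ≤ ((n : ℝ) / Ln n) ^ 4 := pow_nonneg hb _
  unfold cLoc
  exact add_nonneg (add_nonneg (mul_nonneg zero_le_two h1) (mul_nonneg (mul_nonneg (by norm_num) h5) (add_nonneg h2 h3)))
    (mul_nonneg (mul_nonneg (by norm_num) h6) h4)

/-- **`Σ_b cLoc b = 4·cWin`** (the star-box identity on each currency). [folklore] -/
theorem sum_cLoc (u : Tor (fine n M) → ℂ) : ∑ b : Tor M, cLoc n M S u b = 4 * cWin n M S u := by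
  unfold cLoc cWin En Bn
  simp only [sum_add_distrib, ← mul_sum, sum_boxSum_TT]
  rw [sum_filter, nsq, nsq, nsq]
  ring

/-- **the dyadic family**: `Σ_μ Σ_x W_H·|∂ᴴ∂u|² ≤ 4·(2C_J·E + C′_J·B)` — no `|V|`. [folklore] -/
theorem sum_WH_le_unif (V : Finset ((Fin 2 → Bool) × Tor M)) (hV : ∀ v ∈ V, ReentrantAt M S v.1 v.2)
    (hu : ∀ x, ¬ blockReg n M S x → u x = 0) (hn : 2 ≤ n) {J : ℕ} (hJ : 20 * 2 ^ J + 1 ≤ n - 1)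
    {ε : ℝ} (hε : 0 < ε) (hγ : 1 < Real.pi / 3 * (1 - ε / 2)) :
    ∑ μ, ∑ x, WH n M V J x * ‖(Pdir (fine n M) (n : ℂ) μ *ᵥ u) x‖ ^ 2
      ≤ 4 * (2 * (112 + 10 ^ 9 / (Real.pi / 3 * (1 - ε / 2) - 1)) * En n M u
        + (8 / 5 + 4 * Real.pi * (112 + 10 ^ 9 / (Real.pi / 3 * (1 - ε / 2) - 1)) / (ε * (2 - Real.pi / 3 * (1 - ε / 2)))) * Bn n M S u) := by
  unfold WH
  rw [sum_family_eq n M V (fun v x => hessW n M v (n - 1) J x) (fun μ x => ‖(Pdir (fine n M) (n : ℂ) μ *ᵥ u) x‖ ^ 2)]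
  exact sum_vertex_hessian_le n M S V hV hu hn hJ hε hγ

/-- **the corner product windows**: `Σ_μ Σ_x W_P·|∂ᴴ∂u|² ≤ 4·cWin` (`n ≥ 64`). [folklore] -/
theorem sum_WP_le_unif (hu : ∀ x, ¬ blockReg n M S x → u x = 0) (hn : 64 ≤ n) :
    ∑ μ, ∑ x, WP n M S x * ‖(Pdir (fine n M) (n : ℂ) μ *ᵥ u) x‖ ^ 2 ≤ 4 * cWin n M S u := by
  obtain ⟨hK, -, hL1, -, -, h4q, -⟩ := census_arith n hn
  have hPn : Pn n = 2 * Ln n + cn n - 1 := rfl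
  unfold WP
  rw [hPn, sum_family_eq, ← sum_cLoc n M S u]
  refine le_trans (sum_le_sum fun b hb => ?_) (sum_le_sum_of_subset_of_nonneg (subset_univ _) fun b _ _ => cLoc_nonneg n M S u b)
  have hprod : IsProdAt M S b := (mem_filter.mp hb).2
  have h := plainWT_hessian_le_box n M (S := S) (σ := TT) (b := b) (τ₀ := 0) (τ₁ := 0) hu hL1 (c := cn n)
    (hW_corner n M (S := S) hprod (K := 4 * Ln n + cn n + 1) (by omega)) (by omega) (by omega) (by omega) (by omega)
  exact h

/-- **the translated windows**: `Σ_μ Σ_x W_T·|∂ᴴ∂u|² ≤ 60·cWin` (`n ≥ 64`). [folklore] -/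
theorem sum_WT_le_unif (hu : ∀ x, ¬ blockReg n M S x → u x = 0) (hn : 64 ≤ n) :
    ∑ μ, ∑ x, WT n M S x * ‖(Pdir (fine n M) (n : ℂ) μ *ᵥ u) x‖ ^ 2 ≤ 60 * cWin n M S u := by
  obtain ⟨hK, -, hL1, -, -, h4q, -⟩ := census_arith n hn
  have hPn : Pn n = 2 * Ln n + cn n - 1 := rfl
  unfold WT
  rw [hPn, sum_family_eq, show (60 : ℝ) * cWin n M S u = ∑ b : Tor M, 15 * cLoc n M S u b by rw [← mul_sum, sum_cLoc]; ring]
  refine sum_le_sum fun b _ => ?_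
  rw [show (15 : ℝ) = ((Kgrid : Finset (ℕ × ℕ)).card : ℝ) by rw [DirichletVertexDomSum.card_Kgrid]; norm_num]
  refine sum_family_le n M Kgrid (fun k x => plainWT n M (TT, b) (Awin M S b k.1 k.2) (Bwin M S b k.1 k.2)
    (((n / 4 : ℕ) : ℤ) * k.1) (((n / 4 : ℕ) : ℤ) * k.2) (2 * Ln n + cn n - 1) x) _ fun k hk => ?_
  obtain ⟨hk0, hk'⟩ := mem_erase.mp hk
  obtain ⟨hk1, hk2⟩ := mem_product.mp hk'
  rw [mem_range] at hk1 hk2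
  have hq0 : (0 : ℤ) ≤ ((n / 4 : ℕ) : ℤ) := by positivity
  have h4q' : 4 * ((n / 4 : ℕ) : ℤ) ≤ n := by exact_mod_cast h4q
  have hK' : ((4 * Ln n + cn n + 1 : ℕ) : ℤ) + 1 = ((n / 4 : ℕ) : ℤ) := by exact_mod_cast hK
  have hlow : ∀ j : ℕ, j ≠ 0 → ((4 * Ln n + cn n + 1 : ℕ) : ℤ) ≤ ((n / 4 : ℕ) : ℤ) * j := fun j hj => by
    have h := mul_le_mul_of_nonneg_left (show (1 : ℤ) ≤ j by exact_mod_cast Nat.pos_of_ne_zero hj) hq0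
    linarith
  have hhigh' : ∀ j : ℕ, j < 4 → ((n / 4 : ℕ) : ℤ) * j + (4 * Ln n + cn n + 1 : ℕ) + 1 ≤ n := fun j hj => by
    have h := mul_le_mul_of_nonneg_left (show (j : ℤ) ≤ 3 by exact_mod_cast Nat.lt_succ_iff.mp hj) hq0
    linarith
  have hhigh : ∀ j : ℕ, j < 4 → ((n / 4 : ℕ) : ℤ) * j + (4 * Ln n + cn n + 1 : ℕ) ≤ n := fun j hj => by
    have := hhigh' j hj; linarith
  have hnn : ∀ j : ℕ, ((4 * Ln n + cn n + 1 : ℕ) : ℤ) + 1 ≤ n + ((n / 4 : ℕ) : ℤ) * j := fun j => by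
    have h1 : (0 : ℤ) ≤ ((n / 4 : ℕ) : ℤ) * j := by positivity
    linarith
  have hW : ∀ i j : ℤ, tIdx i ≤ (4 * Ln n + cn n + 1 : ℕ) → tIdx j ≤ (4 * Ln n + cn n + 1 : ℕ) →
      (blockReg n M S (emb n M TT b (i + ((n / 4 : ℕ) : ℤ) * k.1) (j + ((n / 4 : ℕ) : ℤ) * k.2))
        ↔ WprodT (Awin M S b k.1 k.2) (Bwin M S b k.1 k.2) (((n / 4 : ℕ) : ℤ) * k.1) (((n / 4 : ℕ) : ℤ) * k.2) i j) := by
    obtain ⟨k₀, k₁⟩ := k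
    simp only at hk0 hk1 hk2 ⊢
    by_cases h0 : k₀ = 0
    · subst h0
      have h1 : k₁ ≠ 0 := fun h1 => hk0 (by rw [h1])
      have e0 : ((n / 4 : ℕ) : ℤ) * ((0 : ℕ) : ℤ) = 0 := by simp
      rw [e0]
      exact hW_fst n M (S := S) (b := b) h1 (by omega) (hlow k₁ h1) (hhigh k₁ hk2)
    · by_cases h1 : k₁ = 0
      · subst h1
        have e1 : ((n / 4 : ℕ) : ℤ) * ((0 : ℕ) : ℤ) = 0 := by simp
        rw [e1]
        exact hW_snd n M (S := S) (b := b) h0 (by omega) (hlow k₀ h0) (hhigh k₀ hk1)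
      · exact hW_both n M (S := S) (b := b) h0 h1 (hlow k₀ h0) (hhigh k₀ hk1) (hlow k₁ h1) (hhigh k₁ hk2)
  exact plainWT_hessian_le_box n M (S := S) (σ := TT) (b := b) hu hL1 (c := cn n) hW (hnn k.1) (hhigh' k.1 hk1) (hnn k.2)
    (hhigh' k.2 hk2)

/-- **the isolated pieces**: `Σ_μ Σ_x W_I·|∂ᴴ∂u|² ≤ 16·cWin` (`n ≥ 64`). [folklore] -/
theorem sum_WI_le_unif (hu : ∀ x, ¬ blockReg n M S x → u x = 0) (hn : 64 ≤ n) :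
    ∑ μ, ∑ x, WI n M S x * ‖(Pdir (fine n M) (n : ℂ) μ *ᵥ u) x‖ ^ 2 ≤ 16 * cWin n M S u := by
  obtain ⟨hK, -, hL1, -, -, h4q, -⟩ := census_arith n hn
  have hc0 := cLoc_nonneg n M S u
  have hPn : Pn n = 2 * Ln n + cn n - 1 := rfl
  have hb : ∀ b : Tor M, ∑ μ, ∑ x, (∑ ay ∈ (univ : Finset (Bool × Bool)).filter (fun ay => IsolatedAt M S TT b ay.1 ay.2),
      pieceW n M (TT, b) ay.1 ay.2 (2 * Ln n + cn n - 1) x) * ‖(Pdir (fine n M) (n : ℂ) μ *ᵥ u) x‖ ^ 2 ≤ 4 * cLoc n M S u b := by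
    intro b
    refine (sum_family_le n M ((univ : Finset (Bool × Bool)).filter (fun ay => IsolatedAt M S TT b ay.1 ay.2))
      (fun ay x => pieceW n M (TT, b) ay.1 ay.2 (2 * Ln n + cn n - 1) x) (fun μ x => ‖(Pdir (fine n M) (n : ℂ) μ *ᵥ u) x‖ ^ 2)
      (c := cLoc n M S u b) fun ay hay => ?_).trans ?_
    · exact pieceW_hessian_le_box n M (S := S) (σ := TT) (b := b) (a := ay.1) (y := ay.2) hu (mem_filter.mp hay).2 hL1 (c := cn n)
        (by omega)
    · refine mul_le_mul_of_nonneg_right ?_ (hc0 b)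
      have h := card_le_univ ((univ : Finset (Bool × Bool)).filter (fun ay => IsolatedAt M S TT b ay.1 ay.2))
      simp only [Fintype.card_prod, Fintype.card_bool] at h
      exact_mod_cast h
  unfold WI
  rw [hPn, sum_family_eq, show (16 : ℝ) * cWin n M S u = ∑ b : Tor M, 4 * cLoc n M S u b by rw [← mul_sum, sum_cLoc]; ring]
  exact sum_le_sum fun b _ => hb b

/-! ## §2 The summed binder in field form, volume-free -/

/-- **THE SUMMED WEIGHTED HESSIAN, FIELD FORM, VOLUME-FREE**: as `DirichletVertexDomSum.dom_sum_field` with `|V| ↦ 4` and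
`20|Tor M| ↦ 80`. [folklore] -/
theorem dom_sum_field_unif (hn : 64 ≤ n) (V : Finset ((Fin 2 → Bool) × Tor M))
    (hV : ∀ v ∈ V, ReentrantAt M S v.1 v.2) (hVre : ∀ σ b, ReentrantAt M S σ b → (σ, b) ∈ V)
    {J : ℕ} (hJ : (n / 4 : ℕ) + 6 ≤ 2 * 2 ^ (J + 3)) (hJn : 20 * 2 ^ J + 1 ≤ n - 1)
    {ε : ℝ} (hε : 0 < ε) (hγ : 1 < Real.pi / 3 * (1 - ε / 2))
    {g : Tor (fine n M) → ℝ} {Cg gmax : ℝ} (hCg : 0 ≤ Cg) (hg0 : ∀ x, 0 ≤ g x) (hgmax : ∀ x, g x ≤ gmax)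
    (hgV : ∀ σ b, (σ, b) ∈ V → ∀ i j : ℤ, ¬ (0 ≤ i ∧ 0 ≤ j) → rho i j ≤ 2 ^ (J + 3) →
      g (emb n M σ b i j) ≤ Cg * (rho i j : ℝ) / n)
    (hu : ∀ x, ¬ blockReg n M S x → u x = 0) :
    ∑ μ, ∑ x ∈ univ.filter (blockReg n M S), g x * ‖(Pdir (fine n M) (n : ℂ) μ *ᵥ u) x‖ ^ 2
      ≤ Cg * (4 * (2 * (112 + 10 ^ 9 / (Real.pi / 3 * (1 - ε / 2) - 1)) * En n M u
          + (8 / 5 + 4 * Real.pi * (112 + 10 ^ 9 / (Real.pi / 3 * (1 - ε / 2) - 1)) / (ε * (2 - Real.pi / 3 * (1 - ε / 2)))) * Bn n M S u))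
        + gmax * (80 * cWin n M S u) := by
  set F : Fin 2 → Tor (fine n M) → ℝ := fun μ x => ‖(Pdir (fine n M) (n : ℂ) μ *ᵥ u) x‖ ^ 2 with hF
  have hF0 : ∀ μ x, 0 ≤ F μ x := fun μ x => sq_nonneg _
  have hgmax0 : 0 ≤ gmax := by
    have := hg0 (emb n M TT 0 0 0); have := hgmax (emb n M TT 0 0 0); linarith
  have step1 : ∑ μ, ∑ x ∈ univ.filter (blockReg n M S), g x * F μ x
      ≤ ∑ μ, ∑ x, (Cg * WH n M V J x + gmax * (WP n M S x + WT n M S x + WI n M S x)) * F μ x := by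
    refine sum_le_sum fun μ _ => ?_
    calc ∑ x ∈ univ.filter (blockReg n M S), g x * F μ x
        ≤ ∑ x ∈ univ.filter (blockReg n M S), (Cg * WH n M V J x + gmax * (WP n M S x + WT n M S x + WI n M S x)) * F μ x :=
          sum_le_sum fun x hx => mul_le_mul_of_nonneg_right
            (dom_pointwise n M S hn V hVre hJ hCg hg0 hgmax hgV (mem_filter.mp hx).2) (hF0 μ x)
      _ ≤ ∑ x, (Cg * WH n M V J x + gmax * (WP n M S x + WT n M S x + WI n M S x)) * F μ x :=
          sum_le_univ_sum_of_nonneg fun x => mul_nonneg (add_nonneg (mul_nonneg hCg (WH_nonneg n M V J x))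
            (mul_nonneg hgmax0 (add_nonneg (add_nonneg (WP_nonneg n M S x) (WT_nonneg n M S x)) (WI_nonneg n M S x)))) (hF0 μ x)
  have step2 : ∑ μ, ∑ x, (Cg * WH n M V J x + gmax * (WP n M S x + WT n M S x + WI n M S x)) * F μ x
      = Cg * ∑ μ, ∑ x, WH n M V J x * F μ x
        + gmax * (∑ μ, ∑ x, WP n M S x * F μ x + ∑ μ, ∑ x, WT n M S x * F μ x + ∑ μ, ∑ x, WI n M S x * F μ x) := by
    simp only [add_mul, mul_add, mul_assoc, sum_add_distrib, mul_sum]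
  have hH := sum_WH_le_unif n M S (u := u) V hV hu (by omega) hJn hε hγ
  have hP := sum_WP_le_unif n M S (u := u) hu hn
  have hT := sum_WT_le_unif n M S (u := u) hu hn
  have hI := sum_WI_le_unif n M S (u := u) hu hn
  rw [hF] at step1 step2
  refine step1.trans ?_
  rw [step2]
  have hsum : ∑ μ, ∑ x, WP n M S x * ‖(Pdir (fine n M) (n : ℂ) μ *ᵥ u) x‖ ^ 2 + ∑ μ, ∑ x, WT n M S x * ‖(Pdir (fine n M) (n : ℂ) μ *ᵥ u) x‖ ^ 2
      + ∑ μ, ∑ x, WI n M S x * ‖(Pdir (fine n M) (n : ℂ) μ *ᵥ u) x‖ ^ 2 ≤ 80 * cWin n M S u := by linarith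
  exact add_le_add (mul_le_mul_of_nonneg_left hH hCg) (mul_le_mul_of_nonneg_left hsum hgmax0)

end Field

/-! ## §3 For the Dirichlet solution of any decidable spelling of the block region -/

/-- **THE VOLUME-FREE CONSTANT OF THE DOMINATED WEIGHTED HESSIAN**: `α_domU = 4C_g·α₁ + 80·g_max·c_U`. [folklore] -/
def alphaDomU (Cg gmax ε a' : ℝ) : ℝ := Cg * 4 * alphaV ε a' + gmax * 80 * cU a'

variable (a' : ℝ)

/-- **THE SUMMED WEIGHTED HESSIAN OF THE DIRICHLET SOLUTION, VOLUME-FREE** for ANY decidable spelling `p` of `blockReg n M S`: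
for `u = solExt n M a′ p f`, `Σ_μ Σ_{x∈Ω} g|∂ᴴ_μ∂_μu|² ≤ α_domU·‖f‖²`. [folklore] -/
theorem dom_sum_solExt_unif (hn : 64 ≤ n) (V : Finset ((Fin 2 → Bool) × Tor M))
    (hV : ∀ v ∈ V, ReentrantAt M S v.1 v.2) (hVre : ∀ σ b, ReentrantAt M S σ b → (σ, b) ∈ V)
    {J : ℕ} (hJ : (n / 4 : ℕ) + 6 ≤ 2 * 2 ^ (J + 3)) (hJn : 20 * 2 ^ J + 1 ≤ n - 1)
    {ε : ℝ} (hε : 0 < ε) (hγ : 1 < Real.pi / 3 * (1 - ε / 2)) (ha' : 0 < a')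
    {g : Tor (fine n M) → ℝ} {Cg gmax : ℝ} (hCg : 0 ≤ Cg) (hg0 : ∀ x, 0 ≤ g x) (hgmax : ∀ x, g x ≤ gmax)
    (hgV : ∀ σ b, (σ, b) ∈ V → ∀ i j : ℤ, ¬ (0 ≤ i ∧ 0 ≤ j) → rho i j ≤ 2 ^ (J + 3) →
      g (emb n M σ b i j) ≤ Cg * (rho i j : ℝ) / n)
    (p : Tor (fine n M) → Prop) [DecidablePred p] (hp : ∀ x, p x ↔ blockReg n M S x) (f : {x // p x} → ℂ) :
    ∑ μ, ∑ x ∈ univ.filter p, g x * ‖(Pdir (fine n M) (n : ℂ) μ *ᵥ solExt n M a' p f) x‖ ^ 2 ≤ alphaDomU Cg gmax ε a' * nsq f := by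
  set u := solExt n M a' p f with hu
  have hu0 : ∀ x, ¬ blockReg n M S x → u x = 0 := fun x hx => solExt_apply_of_not n M a' p f (fun h => hx ((hp x).mp h))
  have hfilt : univ.filter p = univ.filter (blockReg n M S) := filter_congr fun x _ => hp x
  rw [hfilt]
  have hγp := (gammaPs_pos (d := 2) (a' := a')).1
  have hπ3 := Real.pi_gt_three
  have hε2 : ε < 2 := by
    by_contra h
    have : Real.pi / 3 * (1 - ε / 2) ≤ 0 := mul_nonpos_of_nonneg_of_nonpos (by positivity) (by linarith)
    linarith
  have hγ1 : 0 < Real.pi / 3 * (1 - ε / 2) - 1 := by linarith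
  have h2γ : 0 < 2 - Real.pi / 3 * (1 - ε / 2) := by
    have h1 : Real.pi / 3 * (1 - ε / 2) ≤ Real.pi / 3 * 1 := mul_le_mul_of_nonneg_left (by linarith) (by positivity)
    linarith [Real.pi_lt_four]
  have hE : En n M u ≤ (gammaPs 2 a')⁻¹ * nsq f := by
    have h := dirichlet_solExt_le n M a' p ha' f
    rw [dirichlet, Fin.sum_univ_two] at h
    exact h
  have hB : Bn n M S u ≤ 2 * (1 + (a' * (gammaPs 2 a')⁻¹) ^ 2) * nsq f := by
    unfold Bn
    rw [Finset.sum_subtype (univ.filter (blockReg n M S)) (p := p) (fun x => by simp [hp x])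
      (fun x => ‖(LapS (fine n M) (n : ℂ) *ᵥ u) x‖ ^ 2)]
    exact sum_normSq_LapS_solExt_le n M a' p ha' f
  have hN : nsq u ≤ ((gammaPs 2 a')⁻¹) ^ 2 * nsq f := nsq_solExt_le n M a' p ha' f
  have hf0 := nsq_nonneg f
  have hE0 := En_nonneg n M u
  have hB0 := Bn_nonneg n M S u
  have hgmax0 : 0 ≤ gmax := by
    have := hg0 (emb n M TT 0 0 0); have := hgmax (emb n M TT 0 0 0); linarith
  have hnL := nL_le_128 n hn
  have hnL0 : (0 : ℝ) ≤ (n : ℝ) / Ln n := by positivity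
  have hc : cWin n M S u ≤ cU a' * nsq f := by
    unfold cWin cU
    have h2 : ((n : ℝ) / Ln n) ^ 2 ≤ 128 ^ 2 := pow_le_pow_left₀ hnL0 hnL 2
    have h4 : ((n : ℝ) / Ln n) ^ 4 ≤ 128 ^ 4 := pow_le_pow_left₀ hnL0 hnL 4
    have hN0 := nsq_nonneg u
    have t1 : 32 * ((n : ℝ) / Ln n) ^ 2 * En n M u ≤ 32 * 128 ^ 2 * ((gammaPs 2 a')⁻¹ * nsq f) :=
      mul_le_mul (mul_le_mul_of_nonneg_left h2 (by norm_num)) hE hE0 (by positivity)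
    have t2 : 16 * ((n : ℝ) / Ln n) ^ 4 * nsq u ≤ 16 * 128 ^ 4 * (((gammaPs 2 a')⁻¹) ^ 2 * nsq f) :=
      mul_le_mul (mul_le_mul_of_nonneg_left h4 (by norm_num)) hN hN0 (by positivity)
    nlinarith [hB, t1, t2]
  have hfield := dom_sum_field_unif n M S hn V hV hVre hJ hJn hε hγ hCg hg0 hgmax hgV hu0
  refine hfield.trans ?_
  have hC : 0 < 112 + 10 ^ 9 / (Real.pi / 3 * (1 - ε / 2) - 1) := by positivity
  have hC' : 0 ≤ 8 / 5 + 4 * Real.pi * (112 + 10 ^ 9 / (Real.pi / 3 * (1 - ε / 2) - 1)) / (ε * (2 - Real.pi / 3 * (1 - ε / 2))) := by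
    positivity
  have hdy : 2 * (112 + 10 ^ 9 / (Real.pi / 3 * (1 - ε / 2) - 1)) * En n M u
      + (8 / 5 + 4 * Real.pi * (112 + 10 ^ 9 / (Real.pi / 3 * (1 - ε / 2) - 1)) / (ε * (2 - Real.pi / 3 * (1 - ε / 2)))) * Bn n M S u
      ≤ alphaV ε a' * nsq f := by
    unfold alphaV
    nlinarith [mul_le_mul_of_nonneg_left hE (le_of_lt (mul_pos two_pos hC)), mul_le_mul_of_nonneg_left hB hC']
  unfold alphaDomU
  nlinarith [mul_le_mul_of_nonneg_left hdy (mul_nonneg hCg (by norm_num : (0:ℝ) ≤ 4)),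
    mul_le_mul_of_nonneg_left hc (mul_nonneg hgmax0 (by norm_num : (0 : ℝ) ≤ 80))]

end Summit.QuantumFields.BalabanUV.Beta.GAN24.DirichletVertexDomSumU

end
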